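import Summits.QuantumAdvantage.QuantumAdvantage.Theorems.SosSandwichPseudoBoundedAALevelTwoDecoupling
import Literature.Analysis.Quadrature.ChebyshevLobattoRule
import Literature.Algebra.Polynomial.ChebyshevCoefficientFormulas
import Literature.Analysis.Approximation.ChebyshevCoefficientExercises
import HarnessLib

/-!
# Route `SosSandwich`, crux `PseudoBoundedAA` (stmt-QuantumAdvantage-15237): coefficients of bounded polynomials
# via the Chebyshev basis, and the sup norm of the level-`k` part of a bounded low-degree cube function

Support file for the AA ladder (item (3) of the repair census of the level-`k` rung,
`Theorems/SosSandwichPseudoBoundedAALevelKDecoupling.lean` §1 / `…LevelKRung.lean`): there the sup norm of the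
level-`k` part of an `M`-bounded cube function of Fourier degree `≤ d` is bounded by `d^{2k-1}·M/k!` through
`k - 1` Markov inequalities and one Bernstein inequality on the noise polynomial.  Here the `k`-th coefficient of a
polynomial bounded on `[-1, 1]` is read off its CHEBYSHEV expansion instead (the weak form of V. A. Markov's
coefficient inequality, Rivlin 1974 Sect. 2.7 «Size of Coefficients»):

* §1 `abs_discreteCoeff_le` — the discrete Chebyshev coefficients `A_m = (2/n) Σ_{i<n} p(ξ_i) T_m(ξ_i)`
  (Rivlin Ex. 1.5.27 (1.143), tree `ChebyshevLobattoRule.discreteCoeff`) of a polynomial with `|p(ξ_i)| ≤ M` at the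
  zeros `ξ_i` of `T_n` satisfy `|A_m| ≤ 2M` (`|T_m(cos θ)| = |cos mθ| ≤ 1`).
* §2 `abs_coeff_T_le` — the power-basis coefficients of `T_n` satisfy `|t^{(n)}_k| ≤ (2n)^k / k!` for `k ≥ 1`
  (from the tree's closed form (1.96), `ChebyshevCoefficientFormulas.chebyshevT_coeff_eq`:
  `|t^{(n)}_{n-2m}| = 2^{k-1} (2 binom(n-m, m) - binom(n-m-1, m)) ≤ 2^k binom((n+k)/2, k) ≤ (2n)^k/k!`).
* §3 `abs_coeff_le_of_abs_eval_chebyshevZero_le`, `abs_coeff_le_of_forall_abs_eval_le` — **coefficients of a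
  bounded polynomial**: if `deg p ≤ d` and `|p| ≤ M` at the `d + 1` zeros of `T_{d+1}` (in particular if `|p| ≤ M`
  on `[-1, 1]`), then `|a_k(p)| ≤ 2M · d · (2d)^k / k!` for every `k ≥ 1` (expand `p = A_0/2 + Σ_{m=1}^{d} A_m T_m`,
  tree `ChebyshevLobattoRule.eq_sum_discreteCoeff_mul_T`, and add up).  V. A. Markov's sharp form is
  `|a_k| ≤ M·|t^{(d')}_k|`, `d' ∈ {d, d-1}` of the parity of `k`; the weak form loses a factor `≤ 2d` and is what the
  ladder needs: the `d`-exponent drops from `2k - 1` (iterated Markov) to `k + 1`.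
* §4 `abs_levelK_sum_le_chebyshev` — **sup norm of the level-`k` part**: for an `M`-bounded `g` on `{0,1}^N` of
  Fourier degree `≤ d`, `k ≥ 1` and every sign pattern `s`, `|Σ_{|S|=k} ĝ(S) χ_S(s)| ≤ 2M·d·(2d)^k/k!` (the sum is
  the `k`-th coefficient of the noise polynomial `P_s(t) = (T_{(1-t)/2} g)(s)`, which has degree `≤ d` and is
  `M`-bounded on `[-1, 1]`; tree `coeff_noisePoly`, `abs_eval_noisePoly_le`, `degree_noisePoly_le`).

Honest label: support lemmas (constants of the general bottom rung); no stub, crux or summit is proved.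
Sources: Rivlin 1974 Ex. 1.5.27 (1.142)–(1.143), Sect. 1.5 (1.96), Sect. 2.7 (2.38)–(2.42); O'Donnell 2014 §2.4.
-/

-- D-0017: single-conjunct summit ⇒ the duplicate `QuantumAdvantage.QuantumAdvantage` is mandated.
set_option linter.dupNamespace false

noncomputable section

namespace Summit.QuantumAdvantage.QuantumAdvantage.Theorems.SosSandwich.ChebyshevCoefficientBound

open Finset Polynomial Polynomial.Chebyshev Real
open Literature.Analysis.Quadrature.ChebyshevLobattoRule (discreteCoeff eq_sum_discreteCoeff_mul_T)
open Literature.Computability.Complexity.LowDegree (cubeFourierCoeff IsLevelLE)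
open Literature.Probability.RandomGraphs.LowDegree (walsh)
open Summit.QuantumAdvantage.QuantumAdvantage.Theorems.SosSandwich.LevelOneRung (abs_eval_noisePoly_le
  degree_noisePoly_le)
open Summit.QuantumAdvantage.QuantumAdvantage.Theorems.SosSandwich.LevelTwoRung (coeff_noisePoly)

/-! ### §1 Discrete Chebyshev coefficients of a bounded polynomial -/

/-- `|T_m(cos θ)| = |cos(mθ)| ≤ 1`. [cite: Rivlin1974, Sect. 1.1 (1.2)] -/
theorem abs_eval_T_cos_le (m : ℕ) (θ : ℝ) : |(T ℝ m).eval (cos θ)| ≤ 1 := by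
  rw [T_real_cos]
  exact abs_cos_le_one _

/-- **Discrete Chebyshev coefficients are at most `2M`.**  If `|p(ξ_i)| ≤ M` at the `n` zeros
`ξ_i = cos((2i+1)π/(2n))` of `T_n` (`n ≥ 1`), then `|A_m| = |(2/n) Σ_i p(ξ_i) T_m(ξ_i)| ≤ 2M` for every `m`.
[cite: Rivlin1974, Ex. 1.5.27 (1.143)] -/
theorem abs_discreteCoeff_le {n : ℕ} (hn : n ≠ 0) {p : ℝ[X]} {M : ℝ}
    (hb : ∀ i < n, |p.eval (cos ((2 * i + 1) / (2 * n) * π))| ≤ M) (m : ℕ) :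
    |discreteCoeff n p m| ≤ 2 * M := by
  have hnr : (0 : ℝ) < n := by exact_mod_cast Nat.pos_of_ne_zero hn
  have hM0 : 0 ≤ M := (abs_nonneg _).trans (hb 0 (Nat.pos_of_ne_zero hn))
  unfold discreteCoeff
  rw [abs_mul, abs_div, abs_two, abs_of_pos hnr]
  have hsum : |∑ i ∈ range n, p.eval (cos ((2 * i + 1) / (2 * n) * π)) *
      (T ℝ m).eval (cos ((2 * i + 1) / (2 * n) * π))| ≤ n * M := by
    calc |∑ i ∈ range n, p.eval (cos ((2 * i + 1) / (2 * n) * π)) *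
            (T ℝ m).eval (cos ((2 * i + 1) / (2 * n) * π))|
        ≤ ∑ i ∈ range n, |p.eval (cos ((2 * i + 1) / (2 * n) * π)) *
            (T ℝ m).eval (cos ((2 * i + 1) / (2 * n) * π))| := abs_sum_le_sum_abs _ _
      _ ≤ ∑ _i ∈ range n, M := by
          refine sum_le_sum fun i hi => ?_
          rw [abs_mul]
          calc |p.eval (cos ((2 * i + 1) / (2 * n) * π))| * |(T ℝ m).eval (cos ((2 * i + 1) / (2 * n) * π))|
              ≤ M * 1 := mul_le_mul (hb i (mem_range.mp hi)) (abs_eval_T_cos_le m _) (abs_nonneg _) hM0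
            _ = M := mul_one M
      _ = n * M := by rw [sum_const, card_range, nsmul_eq_mul]
  calc 2 / (n : ℝ) * |∑ i ∈ range n, p.eval (cos ((2 * i + 1) / (2 * n) * π)) *
          (T ℝ m).eval (cos ((2 * i + 1) / (2 * n) * π))|
      ≤ 2 / (n : ℝ) * (n * M) := mul_le_mul_of_nonneg_left hsum (by positivity)
    _ = 2 * M := by field_simp

/-! ### §2 The power-basis coefficients of `T_n`: `|t^{(n)}_k| ≤ (2n)^k / k!` -/

/-- **Size of the coefficients of `T_n`**: `|t^{(n)}_k| ≤ (2n)^k / k!` for `k ≥ 1` (and every `n`; the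
coefficient vanishes for `k > n` and for `n + k` odd).  From (1.96):
`|t^{(n)}_{n-2m}| = 2^{k-1}(2 binom(n-m,m) - binom(n-m-1,m)) ≤ 2^k binom(m+k, k) ≤ 2^k (m+k)^k/k! ≤ (2n)^k/k!`
(`k = n - 2m`). [cite: Rivlin1974, Sect. 1.5 (1.96)] -/
theorem abs_coeff_T_le (n : ℕ) {k : ℕ} (hk : 1 ≤ k) :
    |(T ℝ n).coeff k| ≤ (2 * (n : ℝ)) ^ k / (k.factorial : ℝ) := by
  have hpos : (0 : ℝ) ≤ (2 * (n : ℝ)) ^ k / (k.factorial : ℝ) := by positivity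
  by_cases hkn : n < k
  · rw [coeff_eq_zero_of_natDegree_lt
      ((Literature.Analysis.Approximation.ChebyshevCoefficientExercises.natDegree_T_le ℝ n).trans_lt hkn),
      abs_zero]
    exact hpos
  push Not at hkn
  rcases Nat.even_or_odd (n + k) with hev | hodd
  · obtain ⟨m, hm⟩ : ∃ m, n = 2 * m + 1 + (k - 1) := by
      obtain ⟨r, hr⟩ := hev
      exact ⟨(n - k) / 2, by omega⟩
    have h := Literature.Algebra.Polynomial.ChebyshevCoefficientFormulas.chebyshevT_coeff_eq ℝ m (k - 1)
    have hidx : (2 * (m : ℤ) + 1 + ((k - 1 : ℕ) : ℤ)) = (n : ℤ) := by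
      rw [hm]; push_cast; ring
    rw [show k - 1 + 1 = k by omega, hidx, show m + 1 + (k - 1) = m + k by omega] at h
    rw [h]
    have hC12 : (((m + (k - 1)).choose m : ℕ) : ℝ) ≤ (((m + k).choose m : ℕ) : ℝ) := by
      exact_mod_cast Nat.choose_le_choose m (by omega)
    have hC0 : (0 : ℝ) ≤ (((m + (k - 1)).choose m : ℕ) : ℝ) := Nat.cast_nonneg _
    have hchoose : (((m + k).choose m : ℕ) : ℝ) ≤ (n : ℝ) ^ k / (k.factorial : ℝ) := by
      rw [Nat.choose_symm_add]
      calc (((m + k).choose k : ℕ) : ℝ) ≤ ((m + k : ℕ) : ℝ) ^ k / (k.factorial : ℝ) := by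
            exact_mod_cast Nat.choose_le_pow_div (α := ℝ) k (m + k)
        _ ≤ (n : ℝ) ^ k / (k.factorial : ℝ) := by
            gcongr
            exact_mod_cast (show m + k ≤ n by omega)
    calc |(-1 : ℝ) ^ m * 2 ^ (k - 1) *
          (2 * (((m + k).choose m : ℕ) : ℝ) - (((m + (k - 1)).choose m : ℕ) : ℝ))|
        = 2 ^ (k - 1) * |2 * (((m + k).choose m : ℕ) : ℝ) - (((m + (k - 1)).choose m : ℕ) : ℝ)| := by
          rw [abs_mul, abs_mul, abs_pow, abs_neg, abs_one, one_pow, one_mul, abs_pow, abs_two]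
      _ ≤ 2 ^ (k - 1) * (2 * ((n : ℝ) ^ k / (k.factorial : ℝ))) := by
          refine mul_le_mul_of_nonneg_left ?_ (by positivity)
          rw [abs_le]
          constructor <;> linarith
      _ = (2 * (n : ℝ)) ^ k / (k.factorial : ℝ) := by
          have h2 : (2 : ℝ) ^ k = 2 ^ (k - 1) * 2 := by
            rw [← pow_succ]; congr 1; omega
          rw [mul_pow, h2]
          ring
  · rw [Literature.Algebra.Polynomial.ChebyshevCoefficientFormulas.chebyshevT_coeff_eq_zero_of_odd ℝ n k hodd,
      abs_zero]
    exact hpos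

/-- `Σ_{m=1}^{n-1} |t^{(m)}_k| ≤ (n-1)·(2(n-1))^k/k!` for `k ≥ 1`. [cite: Rivlin1974, Sect. 1.5 (1.96)] -/
theorem sum_abs_coeff_T_le (n : ℕ) {k : ℕ} (hk : 1 ≤ k) :
    ∑ m ∈ Ico 1 n, |(T ℝ m).coeff k| ≤
      ((n - 1 : ℕ) : ℝ) * ((2 * ((n - 1 : ℕ) : ℝ)) ^ k / (k.factorial : ℝ)) := by
  calc ∑ m ∈ Ico 1 n, |(T ℝ m).coeff k|
      ≤ ∑ _m ∈ Ico 1 n, (2 * ((n - 1 : ℕ) : ℝ)) ^ k / (k.factorial : ℝ) := by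
        refine sum_le_sum fun m hm => (abs_coeff_T_le m hk).trans ?_
        have hmn : (m : ℝ) ≤ ((n - 1 : ℕ) : ℝ) := by
          have := (mem_Ico.mp hm).2
          exact_mod_cast (show m ≤ n - 1 by omega)
        gcongr
    _ = ((n - 1 : ℕ) : ℝ) * ((2 * ((n - 1 : ℕ) : ℝ)) ^ k / (k.factorial : ℝ)) := by
        rw [sum_const, Nat.card_Ico, nsmul_eq_mul]

/-! ### §3 Coefficients of a bounded polynomial (weak V. A. Markov) -/

/-- For `deg p < n` and `k ≥ 1`: `a_k(p) = Σ_{m=1}^{n-1} A_m · t^{(m)}_k` (the constant `A_0/2` does not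
contribute). [cite: Rivlin1974, Ex. 1.5.27 (1.142)-(1.143)] -/
theorem coeff_eq_sum_discreteCoeff {n : ℕ} (hn : n ≠ 0) (p : ℝ[X]) (hp : p.degree < n) {k : ℕ}
    (hk : 1 ≤ k) : p.coeff k = ∑ m ∈ Ico 1 n, discreteCoeff n p m * (T ℝ m).coeff k := by
  conv_lhs => rw [eq_sum_discreteCoeff_mul_T hn p hp]
  rw [coeff_add, coeff_C, if_neg (by omega), zero_add, finsetSum_coeff]
  exact sum_congr rfl fun m _ => by rw [coeff_C_mul]

/-- `|a_k(p)| ≤ 2M Σ_{m=1}^{n-1} |t^{(m)}_k|` for `deg p < n`, `|p(ξ_i)| ≤ M` at the zeros of `T_n`, `k ≥ 1`.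
[cite: Rivlin1974, Ex. 1.5.27 (1.143); Sect. 2.7 (2.38)-(2.42)] -/
theorem abs_coeff_le_sum {n : ℕ} (hn : n ≠ 0) {p : ℝ[X]} (hp : p.degree < n) {M : ℝ}
    (hb : ∀ i < n, |p.eval (cos ((2 * i + 1) / (2 * n) * π))| ≤ M) {k : ℕ} (hk : 1 ≤ k) :
    |p.coeff k| ≤ 2 * M * ∑ m ∈ Ico 1 n, |(T ℝ m).coeff k| := by
  rw [coeff_eq_sum_discreteCoeff hn p hp hk, mul_sum]
  refine (abs_sum_le_sum_abs _ _).trans (sum_le_sum fun m _ => ?_)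
  rw [abs_mul]
  exact mul_le_mul_of_nonneg_right (abs_discreteCoeff_le hn hb m) (abs_nonneg _)

/-- **Coefficients of a bounded polynomial, nodes form (weak V. A. Markov inequality).**  If `deg p ≤ d` and
`|p(ξ_i)| ≤ M` at the `d + 1` zeros `ξ_i = cos((2i+1)π/(2d+2))` of `T_{d+1}`, then for every `k ≥ 1`
`|a_k(p)| ≤ 2M · d · (2d)^k / k!`. [cite: Rivlin1974, Ex. 1.5.27 (1.143); Sect. 1.5 (1.96); Sect. 2.7 (2.38)-(2.42)] -/
theorem abs_coeff_le_of_abs_eval_chebyshevZero_le {d : ℕ} {p : ℝ[X]} (hp : p.natDegree ≤ d) {M : ℝ}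
    (hb : ∀ i < d + 1, |p.eval (cos ((2 * i + 1) / (2 * ((d + 1 : ℕ) : ℝ)) * π))| ≤ M) {k : ℕ}
    (hk : 1 ≤ k) :
    |p.coeff k| ≤ 2 * M * ((d : ℝ) * ((2 * (d : ℝ)) ^ k / (k.factorial : ℝ))) := by
  have hM0 : 0 ≤ M := (abs_nonneg _).trans (hb 0 (Nat.succ_pos d))
  have hdeg : p.degree < ((d + 1 : ℕ) : WithBot ℕ) :=
    lt_of_le_of_lt (degree_le_of_natDegree_le hp) (by exact_mod_cast Nat.lt_succ_self d)
  have h := abs_coeff_le_sum (Nat.succ_ne_zero d) hdeg hb hk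
  refine h.trans (mul_le_mul_of_nonneg_left ?_ (by positivity))
  have hs := sum_abs_coeff_T_le (d + 1) hk
  rwa [Nat.add_sub_cancel] at hs

/-- **Coefficients of a bounded polynomial, interval form.**  If `deg p ≤ d` and `|p(x)| ≤ M` on `[-1, 1]`, then
`|a_k(p)| ≤ 2M · d · (2d)^k / k!` for every `k ≥ 1` (V. A. Markov's theorem gives the sharp
`|a_k| ≤ M·|t^{(d')}_k|`, `d' ∈ {d, d-1}` of the parity of `k`).
[cite: Rivlin1974, Sect. 2.7 (2.38)-(2.42); Sect. 1.5 (1.96)] -/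
theorem abs_coeff_le_of_forall_abs_eval_le {d : ℕ} {p : ℝ[X]} (hp : p.natDegree ≤ d) {M : ℝ}
    (hb : ∀ x ∈ Set.Icc (-1 : ℝ) 1, |p.eval x| ≤ M) {k : ℕ} (hk : 1 ≤ k) :
    |p.coeff k| ≤ 2 * M * (d : ℝ) * (2 * (d : ℝ)) ^ k / (k.factorial : ℝ) := by
  have h := abs_coeff_le_of_abs_eval_chebyshevZero_le hp
    (fun i _ => hb _ ⟨neg_one_le_cos _, cos_le_one _⟩) hk
  calc |p.coeff k| ≤ 2 * M * ((d : ℝ) * ((2 * (d : ℝ)) ^ k / (k.factorial : ℝ))) := h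
    _ = 2 * M * (d : ℝ) * (2 * (d : ℝ)) ^ k / (k.factorial : ℝ) := by ring

/-! ### §4 Sup norm of the level-`k` part of a bounded low-degree cube function -/

variable {N : ℕ}

/-- **Sup norm of the level-`k` part (Chebyshev form).**  For an `M`-bounded `g : {0,1}^N → ℝ` of Fourier degree
`≤ d`, `k ≥ 1` and every sign pattern `s`: `|Σ_{|S|=k} ĝ(S) χ_S(s)| ≤ 2M · d · (2d)^k / k!` — the `k`-th
coefficient of the noise polynomial `P_s`, of degree `≤ d` and `M`-bounded on `[-1, 1]`.  (The tree's
`LevelKRung.abs_levelK_sum_le` has `d^{2k-1}·M/k!` by iterated Markov; here the `d`-exponent is `k + 1`.)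
[cite: Rivlin1974, Sect. 2.7 (2.38)-(2.42)] [cite: ODonnell2014, §2.4] -/
theorem abs_levelK_sum_le_chebyshev {d : ℕ} {M : ℝ} {g : (Fin N → Bool) → ℝ} (hdeg : IsLevelLE d g)
    (hM : ∀ x, |g x| ≤ M) {k : ℕ} (hk : 1 ≤ k) (s : Fin N → Bool) :
    |∑ S ∈ univ.filter (fun S : Finset (Fin N) => S.card = k), cubeFourierCoeff g S * walsh S s|
      ≤ 2 * M * (d : ℝ) * (2 * (d : ℝ)) ^ k / (k.factorial : ℝ) := by
  rw [← coeff_noisePoly]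
  exact abs_coeff_le_of_forall_abs_eval_le
    (natDegree_le_iff_degree_le.mpr (degree_noisePoly_le hdeg s))
    (fun x hx => abs_eval_noisePoly_le hM s hx) hk

end Summit.QuantumAdvantage.QuantumAdvantage.Theorems.SosSandwich.ChebyshevCoefficientBound

end
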